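import Literature.Analysis.Convexity.Secant
import Literature.Topology.FourManifolds.CreaseNormalFormConstruction
import Mathlib.Analysis.Calculus.ContDiff.RCLike
import HarnessLib

/-!
# Sector bounds: the two numbers of a smooth sector at a vertex

Topic `Literature/Topology/FourManifolds`; input of the vertex stage of the smoothing sweep
(Munkres, Ann. of Math. 72 (1960), §5; Campbell–D'Onofrio–Vítek (2026), Lemma 3.2).  On a smooth
sector the map read by a vertex `z₁` is a `C^∞` map `G` with invertible derivative at `z₁`; the
first reading needs, uniformly on a ball around `z₁`, a lower bound `m ‖w‖ ≤ ‖DG(z) w‖` of the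
derivative and the Euler (Taylor) defect bound `‖DG(z)(z - z₁) - (G z - G z₁)‖ ≤ κ ‖z - z₁‖²`.

* `exists_sector_bounds` — both bounds on some closed ball `closedBall z₁ R₁ ⊆ U` (continuity of
  the derivative; the Taylor estimate from a Lipschitz derivative,
  `Literature.Analysis.Convexity.norm_sub_sub_fderiv_le_of_lipschitzOnWith`);
* `exists_sectorModel` — the sector map itself: for `C^∞` maps `fu`, `ku` with injective
  derivatives at a point `a`, an open partial homeomorphism `ef = fu` about `a` with `C^∞`
  inverse (`ImmersionChart.lean`) such that `ku ∘ ef.symm` is `C^∞` on `ef.target` with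
  invertible derivative at `fu a`.

Everything is proved; no definitions; no named facts.

## References

* J. R. Munkres, *Obstructions to the smoothing of piecewise-differentiable homeomorphisms*, Ann.
  of Math. (2) 72 (1960), 521–554, §5. [Munkres1960]
* D. Campbell, L. D'Onofrio, T. Vítek, *Diffeomorphic approximation of piecewise affine
  homeomorphisms*, J. Geom. Anal. 36 (2026), Lemma 3.2. [CampbellDonofrioVitek2026]
-/

noncomputable section

open Set Function Metric Filter
open scoped Topology ContDiff NNReal

namespace Literature.Topology.FourManifolds

variable {F : Type*} [NormedAddCommGroup F] [NormedSpace ℝ F]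

/-- **Sector bounds.** Let `G` be `C^∞` on an open `U ∋ z₁` with invertible derivative `L₁` at
`z₁`.  Then on some closed ball `closedBall z₁ R₁ ⊆ U` the derivative is bounded below,
`m ‖w‖ ≤ ‖DG(z) w‖`, and the Euler defect is quadratic,
`‖DG(z)(z - z₁) - (G z - G z₁)‖ ≤ κ ‖z - z₁‖²`. [folklore] -/
theorem exists_sector_bounds {G : F → F} {U : Set F} (hU : IsOpen U) {z₁ : F} (hz₁ : z₁ ∈ U)
    (hG : ContDiffOn ℝ ∞ G U) (L₁ : F ≃L[ℝ] F) (hL₁ : HasFDerivAt G (L₁ : F →L[ℝ] F) z₁) :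
    ∃ R₁ m κ : ℝ, 0 < R₁ ∧ 0 < m ∧ 0 ≤ κ ∧ closedBall z₁ R₁ ⊆ U ∧
      (∀ z ∈ closedBall z₁ R₁, ∀ w, m * ‖w‖ ≤ ‖fderiv ℝ G z w‖) ∧
      (∀ z ∈ closedBall z₁ R₁, ‖fderiv ℝ G z (z - z₁) - (G z - G z₁)‖ ≤ κ * ‖z - z₁‖ ^ 2) := by
  -- the lower bound at `z₁`
  set c : ℝ := ‖(L₁.symm : F →L[ℝ] F)‖ + 1 with hc
  have hc0 : 0 < c := by positivity
  have hlow : ∀ w, ‖w‖ ≤ c * ‖L₁ w‖ := fun w => by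
    calc ‖w‖ = ‖L₁.symm (L₁ w)‖ := by rw [L₁.symm_apply_apply]
      _ ≤ ‖(L₁.symm : F →L[ℝ] F)‖ * ‖L₁ w‖ := (L₁.symm : F →L[ℝ] F).le_opNorm _
      _ ≤ c * ‖L₁ w‖ := by gcongr; rw [hc]; linarith
  set m : ℝ := 1 / (2 * c) with hm
  have hm0 : 0 < m := by positivity
  have hmc : 2 * m * c = 1 := by rw [hm]; field_simp
  -- continuity of the derivative: `‖DG z - L₁‖ ≤ m` near `z₁`
  have hcont : ContinuousOn (fderiv ℝ G) U := hG.continuousOn_fderiv_of_isOpen hU (by simp)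
  have hfz₁ : fderiv ℝ G z₁ = (L₁ : F →L[ℝ] F) := hL₁.fderiv
  obtain ⟨Ra, hRa, hRaU, hRaclose⟩ : ∃ Ra > 0, closedBall z₁ Ra ⊆ U ∧
      ∀ z ∈ closedBall z₁ Ra, ‖fderiv ℝ G z - (L₁ : F →L[ℝ] F)‖ ≤ m := by
    have h1 : ∀ᶠ z in 𝓝 z₁, z ∈ U ∧ dist (fderiv ℝ G z) (fderiv ℝ G z₁) < m := by
      have hca : ContinuousAt (fderiv ℝ G) z₁ := hcont.continuousAt (hU.mem_nhds hz₁)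
      exact (hU.mem_nhds hz₁ |> fun h => (eventually_of_mem h fun z hz => hz)).and
        (hca (ball_mem_nhds _ hm0))
    obtain ⟨Ra, hRa, hball⟩ := Metric.eventually_nhds_iff_ball.1 h1
    refine ⟨Ra / 2, by positivity, fun z hz => (hball z ?_).1, fun z hz => ?_⟩
    · exact mem_ball.2 ((mem_closedBall.1 hz).trans_lt (by linarith))
    · have h := (hball z (mem_ball.2 ((mem_closedBall.1 hz).trans_lt (by linarith)))).2
      rw [dist_eq_norm, hfz₁] at h; exact h.le
  -- Lipschitz derivative near `z₁`
  have hC1 : ContDiffAt ℝ 1 (fderiv ℝ G) z₁ :=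
    ((hG.fderiv_of_isOpen hU (m := 1) (WithTop.coe_le_coe.mpr le_top)).contDiffAt (hU.mem_nhds hz₁))
  obtain ⟨K, t, ht, hLip⟩ := hC1.exists_lipschitzOnWith
  obtain ⟨Rb, hRb, hRbt⟩ := Metric.mem_nhds_iff.1 ht
  -- the radius
  set R₁ : ℝ := min Ra (Rb / 2) with hR₁
  have hR₁0 : 0 < R₁ := by positivity
  have hsubU : closedBall z₁ R₁ ⊆ U := (closedBall_subset_closedBall (min_le_left _ _)).trans hRaU
  have hsubt : closedBall z₁ R₁ ⊆ t := fun z hz =>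
    hRbt (mem_ball.2 ((mem_closedBall.1 hz).trans_lt (by
      have := min_le_right Ra (Rb / 2); linarith)))
  refine ⟨R₁, m, K, hR₁0, hm0, K.2, hsubU, fun z hz w => ?_, fun z hz => ?_⟩
  · -- lower bound
    have hclose := hRaclose z (closedBall_subset_closedBall (min_le_left _ _) hz)
    have h1 : ‖(fderiv ℝ G z - (L₁ : F →L[ℝ] F)) w‖ ≤ m * ‖w‖ :=
      ((fderiv ℝ G z - (L₁ : F →L[ℝ] F)).le_opNorm w).trans (by gcongr)
    have h2 : ‖L₁ w‖ ≤ ‖fderiv ℝ G z w‖ + ‖(fderiv ℝ G z - (L₁ : F →L[ℝ] F)) w‖ := by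
      have : (L₁ : F →L[ℝ] F) w = fderiv ℝ G z w - (fderiv ℝ G z - (L₁ : F →L[ℝ] F)) w := by
        simp
      rw [ContinuousLinearEquiv.coe_coe] at this
      rw [this]
      exact norm_sub_le _ _
    have h3 : 2 * m * ‖w‖ ≤ ‖L₁ w‖ := by
      have := hlow w
      calc 2 * m * ‖w‖ ≤ 2 * m * (c * ‖L₁ w‖) := by gcongr
        _ = ‖L₁ w‖ := by rw [← mul_assoc, hmc, one_mul]
    linarith
  · -- the Taylor estimate
    have hG' : ∀ z' ∈ closedBall z₁ R₁, HasFDerivWithinAt G (fderiv ℝ G z') (closedBall z₁ R₁) z' :=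
      fun z' hz' => ((hG.differentiableOn (by simp)).differentiableAt
        (hU.mem_nhds (hsubU hz'))).hasFDerivAt.hasFDerivWithinAt
    have h := Literature.Analysis.Convexity.norm_sub_sub_fderiv_le_of_lipschitzOnWith
      (convex_closedBall z₁ R₁) hG' (hLip.mono hsubt) hz (mem_closedBall_self hR₁0.le)
    have heq : fderiv ℝ G z (z - z₁) - (G z - G z₁) = G z₁ - G z - fderiv ℝ G z (z₁ - z) := by
      rw [show z₁ - z = -(z - z₁) by abel, map_neg]; abel
    rw [heq, norm_sub_rev z z₁, sq, ← mul_assoc]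
    exact h

/-! ### The sector map -/

variable [FiniteDimensional ℝ F]

/-- **The sector map.** For `C^∞` maps `fu`, `ku` with injective derivatives at `a` there is an
open partial homeomorphism `ef = fu` about `a` with `C^∞` inverse such that the sector map
`ku ∘ ef.symm` is `C^∞` on the open set `ef.target ∋ fu a` and has an invertible derivative at
`fu a`. [folklore] -/
theorem exists_sectorModel {fu ku : F → F} (hfu : ContDiff ℝ ∞ fu) (hku : ContDiff ℝ ∞ ku) {a : F}
    (hDfu : Injective (fderiv ℝ fu a)) (hDku : Injective (fderiv ℝ ku a)) :
    ∃ ef : OpenPartialHomeomorph F F, ⇑ef = fu ∧ a ∈ ef.source ∧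
      ContDiffOn ℝ ∞ ef.symm ef.target ∧ ContDiffOn ℝ ∞ (ku ∘ ef.symm) ef.target ∧
      ∃ L : F ≃L[ℝ] F, HasFDerivAt (ku ∘ ef.symm) (L : F →L[ℝ] F) (fu a) := by
  obtain ⟨ef, hef, haef, hefs, hefd⟩ := exists_openPartialHomeomorph_of_injOn_isCompact hfu
    isCompact_singleton (injOn_singleton fu a) (by simpa using hDfu)
  have ha : a ∈ ef.source := haef rfl
  refine ⟨ef, hef, ha, hefs, hku.comp_contDiffOn hefs, ?_⟩
  -- derivatives: `fu` at `a`, `ef.symm` at `fu a`, `ku` at `a`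
  obtain ⟨L₁, hL₁, hL₁s⟩ := exists_hasFDerivAt_symm_equiv ef hef hfu hefs ha
  obtain ⟨L₂, hL₂⟩ := exists_continuousLinearEquiv_eq_of_injective hDku
  have hku' : HasFDerivAt ku (L₂ : F →L[ℝ] F) (ef.symm (fu a)) := by
    rw [← hef, ef.left_inv ha, hL₂]
    exact (hku.differentiable (by simp) a).hasFDerivAt
  refine ⟨L₁.symm.trans L₂, ?_⟩
  have := hku'.comp (fu a) hL₁s
  convert this using 1; exact ContinuousLinearMap.ext fun v => rfl

end Literature.Topology.FourManifolds
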